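import Summits.BirchSwinnertonDyer.BirchSwinnertonDyer.Theorems.DerivedKatoValuationDoorIntegralH1RankLeTwoOfAnalyticRankTwoCrisAtOfPoint
import Summits.BirchSwinnertonDyer.BirchSwinnertonDyer.Theorems.DerivedKatoValuationDoorDerivedKatoDoorRung389a1P5Door
import Literature.NumberTheory.EllipticCurves.KatoRankBound
import Literature.NumberTheory.EllipticCurves.CuspFormLFunction
import Literature.NumberTheory.DiophantineGeometry.Conductor
import HarnessLib

/-!
# Line `birth` on the (β) crux S2 `IntegralH1RankLeTwoOfAnalyticRankTwo` (stmt-BirchSwinnertonDyer-23752):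
# the lead stub N1∣_door reduced to N2∣_door, and the BC5 rung `stub_rung_of_point_of_ordLeTwo` discharged
# MODULO PRINT — generically (Perrin-Riou 2.3.9 dictionary + Kato Thm. 18.4 + modularity) and at the cell
# `(389a1, 5)` with ε and the door DECIDED BY THE KERNEL (LEAD bsd-line-dkd-p1 g3; helper, closes nothing)

Registered skeleton (`Cruxes/IntegralH1RankLeTwoOfAnalyticRankTwo/Lines/birth.lean`): S2 ⟸ `stub_lemme239` (print) ∧
`stub_selCapTwoAtDoorOfAnalyticRankTwo` (N1∣_door: `a = 2 ⇒ s_p ≤ 2` at door primes; OPEN, the lead's stub) ∧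
`stub_crisAtDoorPrimes` (ε; ⟸ one rational point of infinite order, PROVED in
`…IntegralH1RankLeTwoOfAnalyticRankTwoCrisAtOfPoint.lean`), plus the BC5 rung `stub_rung_of_point_of_ordLeTwo`
(«`a = 2`, door, `1 ≤ rank E(ℚ)`, `ord_T L_p(f) ≤ 2` for every newform ⟹ `rank_{ℤ_p} H¹(ℤ[1/p], T_pE) ≤ 2`»,
PLAN-ONLY as registered).  This file records, sorry-free:

* §1 `selmerCorank_le_two_of_order_le_two_of_kato` (per newform) and
  **`selCapTwoAtDoor_of_ordCapTwoAtDoor_of_facts`**: N1∣_door ⟸ N2∣_door («`a = 2 ⇒ ord_T L_p(E,T) ≤ 2` at door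
  primes», node N2 of the S0 lens = `OrdCapAt 2` restricted to door primes) MODULO Kato's bound
  `kato_selmerCorank_le_order_padicLFunction` (Thm. 18.4: `s_p ≤ ord_T L_p`) and modularity `exists_isNewformOf`
  (to have a newform to bound).  So the lead stub's open content is AT MOST N2∣_door mod print; the converse
  N2 ⟸ N1 needs `T`-semisimplicity (descent/output lines of the parent crux) and is not claimed.
* §2 **`rank_integralH1_le_two_of_point_of_order_le_two_of_facts`** — the rung PER NEWFORM modulo TWO print facts
  {PR93 2.3.9 dictionary, Kato 18.4 at `(W, p, f)`}: `1 ≤ rank E(ℚ)` gives ε by the CrisAtOfPoint theorem, Kato gives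
  `s_p ≤ ord_T L_p(f) ≤ 2`, the dictionary gives `rank H¹(ℤ[1/p], T_pE) = s_p ≤ 2` (`p` odd good ordinary; the
  analytic rank and `ρ̄` are NOT used); **`rung_of_point_of_ordLeTwo_of_facts`** — the REGISTERED signature of
  `stub_rung_of_point_of_ordLeTwo` verbatim as conclusion, modulo {PR93 2.3.9, Kato 18.4, modularity}.
* §3 the cell `(389a1, 5)`: **`exists_integral_hasLocPKummerLog_ne_zero_389a1`** — ε_p(389a1) = 1 at EVERY prime,
  UNCONDITIONALLY (kernel certificate `two_le_mordellWeilRank_389a1` + the CrisAtOfPoint theorem; this discharges the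
  `hLoc`/`Loc_5` hypothesis of the parent crux's rung `rung389a1_five_of_sandwich`), and
  **`rank_integralH1_le_two_389a1_five_of_facts`** — the S2-instance `rank_{ℤ_5} H¹(ℤ[1/5], T_5E) ≤ 2` for `E = 389a1`
  modulo {PR93 2.3.9, Kato 18.4 at `(389a1, 5, f)`, a newform `f` carrying the symbol DATA of the atlas cell}: the
  door (`door_389a1_five`), ε_5, `1 ≤ rank` and D-A₂ `ord_T L_5 ≤ 2` (`order_padicLFunction_le_two_389a1_five`, mod
  DATA) are kernel theorems.  This is BC5 made as real as the tree allows today: a cell where BSD-rank is known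
  only through `2 ≤ r` (kernel) and where the line's lever (Euler-system Selmer cap + Poitou–Tate dictionary)
  produces the crux's conclusion from print inputs alone.

HONEST FRAMING.  Every theorem with a named-fact hypothesis is a CONDITIONAL reduction (D-0014, the gate records
`conditional-result`); no stub is proved as registered (the rung as registered quantifies over curves with
`1 ≤ rank`, where ε is now a theorem, but still needs the two print facts); N1∣_door, N2∣_door, S2 and BSD are NOT
proved.  Helper for stmt-BirchSwinnertonDyer-23752; closes nothing.

References: [cite: Kato2004Asterisque, Thm. 18.4 (p. 281) and Thm. 17.4 (p. 273)]; [cite: PerrinRiou1993AIF, Lemme 2.3.9 (p. 967)];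
[cite: KuriharaPollack2007, §1.4 Lemma 1.4]; [cite: MazurTateTeitelbaum1986Invent, §I.10–I.13 and §II.10];
[cite: BreuilConradDiamondTaylor2001, Thm. A]; [cite: CremonaAlgorithms1997, Table 1 (389A1)].
-/

set_option linter.dupNamespace false
set_option autoImplicit false

noncomputable section

open scoped Classical

namespace Summit.BirchSwinnertonDyer.BirchSwinnertonDyer.Theorems.DerivedKatoValuationDoor

open Field
open Literature Literature.NumberTheory.GaloisRepresentations
open Literature.NumberTheory.EllipticCurves Literature.NumberTheory.EllipticCurves.ModularForms
open Literature.NumberTheory.EllipticCurves.Kato2004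
open Literature.NumberTheory.EllipticCurves.Kato2004.EulerSystemValues
open CongruenceSubgroup
open Summit.BirchSwinnertonDyer.BirchSwinnertonDyer.Rank2Observatory

/-! ## §1 N1∣_door from N2∣_door modulo Kato's Thm. 18.4 (and modularity) -/

section PerNewform

variable (W : WeierstrassCurve ℚ) [W.IsElliptic] [W.IsGloballyMinimal] (p : ℕ) [Fact p.Prime]
  {N : ℕ} [NeZero N] {f : CuspForm (Gamma0 N) 2}

omit [W.IsElliptic] in
/-- **`s_p ≤ 2` from `ord_T L_p(f, α_p; T) ≤ 2`, per newform, MODULO Kato's Thm. 18.4 at `(W, p, f)`**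
(`kato_selmerCorank_le_order_padicLFunction`: `corank Sel_{p^∞}(W/ℚ) ≤ ord_{T=0} L_p` at an odd good ordinary prime).
CONDITIONAL on the named fact. [cite: Kato2004Asterisque, Thm. 18.4 (p. 281)] -/
theorem selmerCorank_le_two_of_order_le_two_of_kato
    (hKato : kato_selmerCorank_le_order_padicLFunction W p (f := f)) (hp2 : p ≠ 2)
    (hord : IsOrdinaryAt W p) (hf : IsNewformOf W f)
    (h2 : (padicLFunction f (unitRoot W p : ℚ_[p])).order ≤ 2) : W.selmerCorank p ≤ 2 := by
  have h := (hKato hp2 hord hf).trans h2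
  exact_mod_cast h

end PerNewform

/-- **N1∣_door ⟸ N2∣_door modulo print.**  If `ord_{T=0} L_p(f, α_p; T) ≤ 2` for every newform `f` of every
globally minimal analytic-rank-two `W/ℚ` at every door prime (N2∣_door, the order half of `p`-adic BSD at `a = 2`,
OPEN), then `s_p ≤ 2` there (N1∣_door = the registered lead stub `stub_selCapTwoAtDoorOfAnalyticRankTwo` verbatim as
conclusion) — GIVEN Kato's Thm. 18.4 as a named fact for all `(W, p, f)` and modularity (`exists_isNewformOf`, to
produce the newform at level `N_W`; `N_W ≠ 0` by the tree theorem `conductorNorm_pos_holds`).  CONDITIONAL reduction;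
neither node is proved. [cite: Kato2004Asterisque, Thm. 18.4 (p. 281)] [cite: BreuilConradDiamondTaylor2001, Thm. A]
[cite: MazurTateTeitelbaum1986Invent, §II.10] -/
theorem selCapTwoAtDoor_of_ordCapTwoAtDoor_of_facts
    (hKato : ∀ (W : WeierstrassCurve ℚ) [W.IsElliptic] [W.IsGloballyMinimal] (p : ℕ) [Fact p.Prime]
      {N : ℕ} [NeZero N] (f : CuspForm (Gamma0 N) 2), kato_selmerCorank_le_order_padicLFunction W p (f := f))
    (hMod : exists_isNewformOf)
    (hN2 : ∀ (W : WeierstrassCurve ℚ) [W.IsElliptic] [W.IsGloballyMinimal] (p : ℕ) [Fact p.Prime],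
      W.analyticRank = 2 →
        (5 ≤ p ∧ Literature.NumberTheory.EllipticCurves.IsOrdinaryAt W p ∧ W.HasSurjectiveModNGaloisRep p) →
          ∀ {N : ℕ} [NeZero N] (f : CuspForm (Gamma0 N) 2), IsNewformOf W f →
            (padicLFunction f (unitRoot W p : ℚ_[p])).order ≤ 2) :
    ∀ (W : WeierstrassCurve ℚ) [W.IsElliptic] [W.IsGloballyMinimal] (p : ℕ) [Fact p.Prime],
      W.analyticRank = 2 →
        (5 ≤ p ∧ Literature.NumberTheory.EllipticCurves.IsOrdinaryAt W p ∧ W.HasSurjectiveModNGaloisRep p) →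
          W.selmerCorank p ≤ 2 := by
  intro W _ _ p _ ha hdoor
  haveI : NeZero (W.conductorNorm ℤ) := ⟨(W.conductorNorm_pos_holds).ne'⟩
  obtain ⟨f, hf⟩ := hMod W
  have hp2 : p ≠ 2 := by
    have h5 := hdoor.1
    omega
  exact selmerCorank_le_two_of_order_le_two_of_kato W p (hKato W p f) hp2 hdoor.2.1 hf (hN2 W p ha hdoor f hf)

/-! ## §2 The BC5 rung modulo print: per newform (two facts), and the registered signature (three facts) -/

section Rung

variable (W : WeierstrassCurve ℚ) [W.IsElliptic] [W.IsGloballyMinimal] (p : ℕ) [Fact p.Prime]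
  [ContinuousSMul ℤ_[p] (W.tateModule p)] {N : ℕ} [NeZero N] {f : CuspForm (Gamma0 N) 2}

/-- **The rung per newform, modulo two print facts.**  At an odd good ordinary prime `p` of a globally minimal `W/ℚ`
with a rational point of infinite order (`1 ≤ rank E(ℚ)`) and a newform `f` of `W` with `ord_{T=0} L_p(f, α_p; T) ≤ 2`:
`rank_{ℤ_p} H¹(ℤ[1/p], T_pW) ≤ 2` — GIVEN Perrin-Riou's dictionary `lemme239_rank_integralH1_eq_selmerCorank` and Kato's
Thm. 18.4 at `(W, p, f)`.  The third ingredient, ε_p = 1, is a THEOREM here: the integral Kummer class of the point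
(`exists_integral_hasLocPKummerLog_ne_zero_of_mordellWeilRank_ne_zero`).  Neither the analytic rank nor `ρ̄_{W,p}` is
used. [cite: PerrinRiou1993AIF, Lemme 2.3.9 (p. 967)] [cite: Kato2004Asterisque, Thm. 18.4 (p. 281)] [cite: BlochKato1990, Ex. 3.11] -/
theorem rank_integralH1_le_two_of_point_of_order_le_two_of_facts
    (hPR : PerrinRiou1993.lemme239_rank_integralH1_eq_selmerCorank)
    (hKato : kato_selmerCorank_le_order_padicLFunction W p (f := f)) (hp2 : p ≠ 2) (hord : IsOrdinaryAt W p)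
    (hf : IsNewformOf W f) (hr : 1 ≤ W.mordellWeilRank)
    (h2 : (padicLFunction f (unitRoot W p : ℚ_[p])).order ≤ 2) :
    Module.rank ℤ_[p] ↥(integralH1 (tateRep W p) p ⊤) ≤ 2 :=
  rank_integralH1_le_two_of_lemme239 W p hPR hp2 ((isOrdinaryAt_iff W p).1 hord).1
    (selmerCorank_le_two_of_order_le_two_of_kato W p hKato hp2 hord hf h2)
    (exists_integral_hasLocPKummerLog_ne_zero_of_mordellWeilRank_ne_zero W p (by omega))

end Rung

/-- **The REGISTERED signature of `stub_rung_of_point_of_ordLeTwo` (line `birth`, stmt-BirchSwinnertonDyer-23752)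
verbatim as conclusion, modulo three print facts** {Perrin-Riou 2.3.9 dictionary, Kato Thm. 18.4 for all `(W, p, f)`,
modularity}: at a door prime, `p` is odd good ordinary; modularity supplies a newform at level `N_W`, the rung's own
hypothesis bounds its `ord_T L_p` by `2`, and §2 applies (ε from the point, unconditionally).  CONDITIONAL; the stub
is not proved as registered (the two Iwasawa-theoretic facts are unproved in the tree, size XL/L).
[cite: PerrinRiou1993AIF, Lemme 2.3.9 (p. 967)] [cite: Kato2004Asterisque, Thm. 18.4 (p. 281)]
[cite: BreuilConradDiamondTaylor2001, Thm. A] -/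
theorem rung_of_point_of_ordLeTwo_of_facts
    (hPR : PerrinRiou1993.lemme239_rank_integralH1_eq_selmerCorank)
    (hKato : ∀ (W : WeierstrassCurve ℚ) [W.IsElliptic] [W.IsGloballyMinimal] (p : ℕ) [Fact p.Prime]
      {N : ℕ} [NeZero N] (f : CuspForm (Gamma0 N) 2), kato_selmerCorank_le_order_padicLFunction W p (f := f))
    (hMod : exists_isNewformOf) :
    ∀ (W : WeierstrassCurve ℚ) [W.IsElliptic] [W.IsGloballyMinimal] (p : ℕ) [Fact p.Prime]
      [ContinuousSMul ℤ_[p] (W.tateModule p)], W.analyticRank = 2 →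
      (5 ≤ p ∧ IsOrdinaryAt W p ∧ W.HasSurjectiveModNGaloisRep p) → 1 ≤ W.mordellWeilRank →
      (∀ {N : ℕ} [NeZero N] (f : CuspForm (CongruenceSubgroup.Gamma0 N) 2), IsNewformOf W f →
        (padicLFunction f (unitRoot W p : ℚ_[p])).order ≤ 2) →
      Module.rank ℤ_[p] ↥(integralH1 (tateRep W p) p ⊤) ≤ 2 := by
  intro W _ _ p _ _ _ha hdoor hr hN2
  haveI : NeZero (W.conductorNorm ℤ) := ⟨(W.conductorNorm_pos_holds).ne'⟩
  obtain ⟨f, hf⟩ := hMod W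
  have hp2 : p ≠ 2 := by
    have h5 := hdoor.1
    omega
  exact rank_integralH1_le_two_of_point_of_order_le_two_of_facts W p hPR (hKato W p f) hp2 hdoor.2.1 hf hr
    (hN2 f hf)

/-! ## §3 The cell `(389a1, 5)`: ε by the kernel, the S2-instance modulo print + symbol DATA -/

/-- **ε_p(389a1) = 1 at EVERY prime `p`, unconditionally**: `389a1` has `2 ≤ rank E(ℚ)` by the kernel certificate
`two_le_mordellWeilRank_389a1`, so some integral class of `H¹(ℤ[1/p], T_pE)` has a Kummer localisation of non-zero
logarithm (`exists_integral_hasLocPKummerLog_ne_zero_of_mordellWeilRank_ne_zero`).  This is the `Loc_p` / `hLoc`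
input of the parent crux's `(389a1, 5)` rung (`rung389a1_five_of_sandwich`), now a theorem.
[cite: CremonaAlgorithms1997, Table 1 (389A1)] [cite: BlochKato1990, Ex. 3.11] -/
theorem exists_integral_hasLocPKummerLog_ne_zero_389a1 (p : ℕ) [Fact p.Prime]
    [(c389a1.e.baseChange ℚ).IsElliptic] [(c389a1.e.baseChange ℚ).IsGloballyMinimal]
    [ContinuousSMul ℤ_[p] ((c389a1.e.baseChange ℚ).tateModule p)] :
    ∃ (x : H1 (tateRep (c389a1.e.baseChange ℚ) p) ⊤) (t : ℚ_[p]),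
      x ∈ integralH1 (tateRep (c389a1.e.baseChange ℚ) p) p ⊤ ∧ t ≠ 0 ∧
        HasLocPKummerLog (c389a1.e.baseChange ℚ) p x t :=
  exists_integral_hasLocPKummerLog_ne_zero_of_mordellWeilRank_ne_zero _ p
    (by have := two_le_mordellWeilRank_389a1; omega)

/-- **The S2-instance at `(389a1, 5)` modulo print + DATA**: `rank_{ℤ_5} H¹(ℤ[1/5], T_5E) ≤ 2` for `E = 389a1`, GIVEN
Perrin-Riou's dictionary fact, Kato's Thm. 18.4 at `(389a1, 5, f)` and a newform `f` of `389a1` carrying the symbol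
DATA of the atlas cell (`hdata`, as in `order_padicLFunction_le_two_389a1_five`).  Kernel-side: `5` is odd and good
ordinary for `389a1` (`isOrdinaryAt_389a1_five`), `1 ≤ 2 ≤ rank E(ℚ)` (`two_le_mordellWeilRank_389a1`) hence ε_5,
and D-A₂ `ord_T L_5(f) ≤ 2` from the level-`25` Riemann sum (mod DATA).  The door at `(389a1, 5)` holds
(`door_389a1_five`) although it is not even needed for this instance.  BC5 of the line, CONDITIONAL on print.
[cite: Kato2004Asterisque, Thm. 18.4 (p. 281)] [cite: PerrinRiou1993AIF, Lemme 2.3.9 (p. 967)]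
[cite: MazurTateTeitelbaum1986Invent, §I.10–I.13] [cite: CremonaAlgorithms1997, Table 1 (389A1)] -/
theorem rank_integralH1_le_two_389a1_five_of_facts [Fact (5 : ℕ).Prime]
    [(c389a1.e.baseChange ℚ).IsElliptic] [(c389a1.e.baseChange ℚ).IsGloballyMinimal]
    [ContinuousSMul ℤ_[5] ((c389a1.e.baseChange ℚ).tateModule 5)]
    (hPR : PerrinRiou1993.lemme239_rank_integralH1_eq_selmerCorank)
    {N : ℕ} [NeZero N] {f : CuspForm (Gamma0 N) 2} (hf : IsNewformOf (c389a1.e.baseChange ℚ) f)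
    (hKato : kato_selmerCorank_le_order_padicLFunction (c389a1.e.baseChange ℚ) 5 (f := f))
    (hdata : ∀ c ∈ c389a1.cells, c.p = 5 → ∃ D : ℚ, ‖(D : ℚ_[5])‖ = 1 ∧
      (∀ x : ℚ, ‖(ratPlusSymbol f x : ℚ_[5])‖ ≤ 1) ∧
      ∀ u : ℕ, u < 5 ^ (c.n + 1) → ¬ 5 ∣ u →
        ratPlusSymbol f ((u : ℚ) / (5 : ℚ) ^ (c.n + 1)) = (c.tabHi.getD u 0 : ℚ) / D ∧
        ratPlusSymbol f ((u : ℚ) / (5 : ℚ) ^ c.n) = (c.tabLo.getD (u % 5 ^ c.n) 0 : ℚ) / D) :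
    Module.rank ℤ_[5] ↥(integralH1 (tateRep (c389a1.e.baseChange ℚ) 5) 5 ⊤) ≤ 2 :=
  rank_integralH1_le_two_of_point_of_order_le_two_of_facts _ 5 hPR hKato (by decide) isOrdinaryAt_389a1_five hf
    (le_trans (by norm_num) two_le_mordellWeilRank_389a1) (order_padicLFunction_le_two_389a1_five hf hdata)

/-- **The same S2-instance packaged with its door**: at `(389a1, 5)` the door triple holds (kernel) and the rank cap
holds modulo {PR93 2.3.9, Kato 18.4 at the cell, newform + DATA} — i.e. the crux's implication
`a = 2 → door → rank ≤ 2` has a TRUE antecedent door here and a conclusion discharged from print inputs.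
[cite: Serre1972, §2.8 Prop. 19] [cite: Kato2004Asterisque, Thm. 18.4 (p. 281)] -/
theorem door_and_rank_integralH1_le_two_389a1_five_of_facts [Fact (5 : ℕ).Prime]
    [(c389a1.e.baseChange ℚ).IsElliptic] [(c389a1.e.baseChange ℚ).IsGloballyMinimal]
    [ContinuousSMul ℤ_[5] ((c389a1.e.baseChange ℚ).tateModule 5)]
    (hPR : PerrinRiou1993.lemme239_rank_integralH1_eq_selmerCorank)
    {N : ℕ} [NeZero N] {f : CuspForm (Gamma0 N) 2} (hf : IsNewformOf (c389a1.e.baseChange ℚ) f)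
    (hKato : kato_selmerCorank_le_order_padicLFunction (c389a1.e.baseChange ℚ) 5 (f := f))
    (hdata : ∀ c ∈ c389a1.cells, c.p = 5 → ∃ D : ℚ, ‖(D : ℚ_[5])‖ = 1 ∧
      (∀ x : ℚ, ‖(ratPlusSymbol f x : ℚ_[5])‖ ≤ 1) ∧
      ∀ u : ℕ, u < 5 ^ (c.n + 1) → ¬ 5 ∣ u →
        ratPlusSymbol f ((u : ℚ) / (5 : ℚ) ^ (c.n + 1)) = (c.tabHi.getD u 0 : ℚ) / D ∧
        ratPlusSymbol f ((u : ℚ) / (5 : ℚ) ^ c.n) = (c.tabLo.getD (u % 5 ^ c.n) 0 : ℚ) / D) :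
    (5 ≤ 5 ∧ IsOrdinaryAt (c389a1.e.baseChange ℚ) 5 ∧ (c389a1.e.baseChange ℚ).HasSurjectiveModNGaloisRep 5) ∧
      Module.rank ℤ_[5] ↥(integralH1 (tateRep (c389a1.e.baseChange ℚ) 5) 5 ⊤) ≤ 2 :=
  ⟨door_389a1_five, rank_integralH1_le_two_389a1_five_of_facts hPR hf hKato hdata⟩

end Summit.BirchSwinnertonDyer.BirchSwinnertonDyer.Theorems.DerivedKatoValuationDoor

end
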